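import Summits.MatrixMultiplication.OmegaCensus.STPP222PentaOrder72

/-!
# ω-census, STPP pattern `(2,2,2)⁴` at order `60` in 2-rank `2`: a kernel witness in `ℤ/2 × ℤ/30`

HONEST FRAMING (pub-omega census; verbatim): lottery ticket; floor = certified bounds/negative ranges.
Census STRUCTURE bookkeeping (the onset of `k = 4` simultaneous-TPP triples of 2-subsets, CKSU 2005 Def. 5.1, tree form
`IsSTPP`, as a function of the 2-rank), not progress on `ω`: a `(2,2,2)⁴` STPP family yields no matrix-multiplication bound
of interest.

Pre-registrations P-012.24 / P-014.5 (pub-omega, 2026-08-23) predicted `(2,2,2)⁴` INFEASIBLE in `ℤ/2 × ℤ/30`; the dedicated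
exhaustive solver `s222` (seat pub-omega-stpp-2, kit j187586) instead returned a witness after `1.14·10¹¹` nodes (a MISS of both
cells).  This file is the kernel form of that witness:

* `exists_isSTPP_222tetra_2_30` — `ℤ/2 × ℤ/30` (order `60`, 2-rank `2`) admits `A B C : Fin 4 → Finset _`, all of cardinality `2`,
  with `IsSTPP A B C` (checked by `decide` on the Boolean transcription `stppCheck`, `4096` word instances);
* `card_eq_60_tetra_2_30` — its order is `60`; with the kernel packing bound `card_ge_of_isSTPP_222pow` (`8k − 4 ≤ |G|`, here `28`)
  recorded as `tetra_2_30_bracket`.  Together with `exists_isSTPP_222tetra_seed_2_2_2_7` (order `56`, 2-rank `3`) the tree now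
  holds `(2,2,2)⁴` witnesses in 2-rank `3` at order `56` and in 2-rank `2` at order `60`; which abelian groups of order `56–59`
  and 2-rank `≤ 2` lack `(2,2,2)⁴` is census business (search verdicts ×1/×2), not claimed here.

References: H. Cohn, R. Kleinberg, B. Szegedy, C. Umans, FOCS 2005 (arXiv:math/0511460), Def. 5.1.
Record: pub-omega HOME `pub-omega-stpp-2-g6/results/s222/kit-j187586/Z2xZ30-222x4-witness.json` (sha16 e9404f70…; element code
`30a + b`; literal Def-5.1 checks ×2 before this file).
-/

open Literature.Computability.AlgebraicComplexity Finset

namespace Summit.MatrixMultiplication.OmegaCensus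

/-- **`(2,2,2)⁴` at order 60, 2-rank 2:** `ℤ/2 × ℤ/30` admits four simultaneous-TPP triples of 2-subsets
(kernel-checked witness of kit j187586; P-012.24 / P-014.5 MISS). [cite: CohnKleinbergSzegedyUmans2005, Def. 5.1] -/
theorem exists_isSTPP_222tetra_2_30 :
    ∃ A B C : Fin 4 → Finset (ZMod 2 × ZMod 30), IsSTPP A B C ∧
      ∀ i, (A i).card = 2 ∧ (B i).card = 2 ∧ (C i).card = 2 :=
  exists_isSTPP_222pow_of_lists (H := ZMod 2 × ZMod 30)
    ![[(0, 0), (0, 1)], [(0, 0), (0, 2)], [(0, 0), (0, 15)], [(0, 0), (1, 0)]]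
    ![[(0, 0), (0, 15)], [(0, 27), (1, 27)], [(0, 24), (0, 1)], [(0, 21), (0, 2)]]
    ![[(0, 0), (1, 0)], [(0, 7), (0, 22)], [(0, 18), (1, 18)], [(1, 13), (1, 28)]]
    (by decide +kernel) (by decide +kernel)

/-- The witness group has order `60`. -/
theorem card_eq_60_tetra_2_30 : Fintype.card (ZMod 2 × ZMod 30) = 60 := by
  simp only [Fintype.card_prod, ZMod.card]

/-- The kernel bracket at `k = 4` in this group: the packing bound `8k − 4 ≤ |G|` (`card_ge_of_isSTPP_222pow`) reads `28 ≤ 60`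
here, and the witness above shows the pattern is attained. [cite: CohnKleinbergSzegedyUmans2005, Def. 5.1] -/
theorem tetra_2_30_bracket :
    (∃ A B C : Fin 4 → Finset (ZMod 2 × ZMod 30), IsSTPP A B C ∧
      ∀ i, (A i).card = 2 ∧ (B i).card = 2 ∧ (C i).card = 2) ∧
    8 * 4 - 4 ≤ Fintype.card (ZMod 2 × ZMod 30) := by
  refine ⟨exists_isSTPP_222tetra_2_30, ?_⟩
  obtain ⟨A, B, C, hS, hc⟩ := exists_isSTPP_222tetra_2_30
  exact card_ge_of_isSTPP_222pow hS hc

end Summit.MatrixMultiplication.OmegaCensus
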